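import Summits.BirchSwinnertonDyer.Rank1Residual.X1.KellerYinIMC2HalvesPub
import Literature.NumberTheory.EllipticCurves.CuspFormLFunctionLevelConductorProofs
import HarnessLib

/-!
# Crux 2 `GoodLatticeBDPValue` (stmt-BirchSwinnertonDyer-19032), line `halves`: the PUBLISHED input
# "level `=` conductor" (Carayol 1986) is IDLE — H1 / L-div / L-val / `h308` re-threaded WITHOUT it

Cell `bsd-eis` (home `run/shared/lean/pub/bsd-eis/`), width seat `bsd-line-x1-p1-w3` (gen 7) on crux 2
`GoodLatticeBDPValue`, registered line `halves` v22 (`Cruxes/GoodLatticeBDPValue/Lines/halves.lean`,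
sha256 873a80a3…). Stub 1 of that skeleton (`stub_publishedFacts`, seven PUBLISHED named facts) carries as
its second conjunct Carayol's level theorem in the tree's form
`∀ (N : ℕ) [NeZero N], IsNewformOf.level_eq_conductorNorm (N := N)` ("the newform `f ∈ S₂(Γ₀(N))` of `W`
has `N = N_W`"). Head-on trace of the line's glue: that conjunct is consumed ONLY by the three class-X1
leaves `KellerYinHalves.goodBDPExistsOnTree_of_castellaHsieh2018` (H1),
`KellerYinHalves.goodLatticeDivOnTree_of_cgls` (L-div) and `KellerYinHalves.goodBDPValueOnTree_of_cgls`
(L-val) — through `KellerYinHalves.thm308_of_cgls_of_muLambda` and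
`GoodLatticeBDPValueOfLambdaInequalityAnQ.goodLatticeBDPValue_of_pub_of_leTD_of_le_of_anQ` (p650549) — and
in each leaf it serves exactly two lines: `p ∤ N` and the Heegner hypothesis for the level `N` of the
parametrisation datum `Dt`, both read off `N = N_W`.

Both consequences hold WITHOUT Carayol's theorem, by `q`-expansion arithmetic already in the tree:
`IsNewformOf.dvd_level_iff_dvd_conductorNorm` (`CuspFormLFunctionLevelConductorProofs`: the
`a_{p²}`-recursions `a_{p²} = a_p² − 𝟙(p)·p` on the form side (Diamond–Shurman Prop. 5.8.5) and on the
curve side (Diamond–Shurman (8.44)) force `𝟙_N(p) = 𝟙_{N_W}(p)`, i.e. THE LEVEL AND THE CONDUCTOR HAVE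
THE SAME PRIME DIVISORS — unconditional, no input from Carayol), and the definition of
`SatisfiesHeegnerHypothesis N K` (every PRIME divisor of `N` splits in `K` — a condition on the prime
support of `N` only).

* §0 `not_dvd_level_of_good` (`p` good for `W` ⟹ `p ∤ N`), `satisfiesHeegnerHypothesis_level_iff`
  ((Heeg) for `N` ⟺ (Heeg) for `N_W`).
* §1 `goodBDPExistsOnTree_of_castellaHsieh2018'`, `goodLatticeDivOnTree_of_cgls'`,
  `goodBDPValueOnTree_of_cgls'` — the three leaves with the hypothesis `hC` DELETED; the proofs are
  those of `X1/KellerYinIMC2HalvesH1.lean` / `X1/KellerYinIMC2HalvesPub.lean` (seat `bsd-eis-ky` gen 5/6)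
  verbatim except for the two lines above.
* §2 `thm308_of_cgls_of_muLambda'` — `KellerYin2024.thm308_imc2_bdpValue_goodLattice_OPEN` (KY Thm. 3.0.8
  at the good lattice) from THREE published named facts (Castella–Hsieh 2018 existence, CGLS 2022 proof of
  Thm. 4.2.2 first half, CGLS 2022 Thm. 5.1.3) and the one statement `GoodLatticeMuLambdaOnTree` — the
  old `thm308_of_cgls_of_muLambda` minus Carayol.

So on line `halves` the conjunct "Carayol" of stub 1 can be dropped (stub 1: 7 → 6 conjuncts; the line's
named facts 20 → 19): a RESHAPE OPTION for the LEAD, composed in the companion file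
`EisensteinPrimesGoodLatticeBDPValueOfNamedFactsNoCarayol.lean`. HONEST FRAMING: input bookkeeping only —
every theorem here is CONDITIONAL on the remaining named PUBLISHED facts (hypotheses by name); no stub of
v22 is closed; no summit statement / BSD / IMC / Keller–Yin theorem is proved; BSD is proved for no curve.

References: [DiamondShurman2005] Prop. 5.8.5, (8.44), Thm. 8.8.1; [Carayol1986] (the input removed);
[CastellaHsieh2018] Def. 3.5, Prop. 3.6; [CastellaGrossiLeeSkinner2022] Thm. 4.1.2, Rem. 4.1.3,
Prop. 4.2.1, proof of Thm. 4.2.2, Thm. 5.1.3; [KellerYin2024] Thm. 3.0.8.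
-/

-- `Summit.BirchSwinnertonDyer.BirchSwinnertonDyer.…`: the summit and its single sub-problem share a name (D-0017 layout).
set_option linter.dupNamespace false
set_option autoImplicit false

noncomputable section

open scoped Classical MatrixGroups ModularForm

open PowerSeries WeierstrassCurve NumberField IsDedekindDomain Field CongruenceSubgroup
  Literature.NumberTheory.EllipticCurves Literature.NumberTheory.EllipticCurves.ModularForms
  Literature.NumberTheory.QuadraticFields Literature.NumberTheory.EllipticCurves.Rank1Residual
  Literature.NumberTheory.EllipticCurves.Castella2018
  Literature.NumberTheory.EllipticCurves.KellerYin2024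
  Literature.NumberTheory.EllipticCurves.CastellaGrossiLeeSkinner2022
  Summit.BirchSwinnertonDyer.Rank1Residual.X11b.Halves
  Summit.BirchSwinnertonDyer.Rank1Residual
  Summit.BirchSwinnertonDyer.Rank1Residual.X1.KellerYinHalves

namespace Summit.BirchSwinnertonDyer.BirchSwinnertonDyer.Theorems.GoodLatticeBDPValueHalvesNoCarayol

/-! ## §0 What the line needs from "level `=` conductor", proved without it -/

section Level

variable {N : ℕ} [NeZero N] {W : WeierstrassCurve ℚ} [W.IsElliptic] {f : CuspForm (Gamma0 N) 2}

/-- **A good prime of `W` does not divide the level of its newform** (any level `N`,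
`IsNewformOf W f`): `p ∣ N ↔ p ∣ N_W` by the `a_{p²}`-recursions on both sides
(`IsNewformOf.dvd_level_iff_dvd_conductorNorm`, unconditional), and `p ∣ N_W ↔ p` is bad
(`dvd_conductorNorm_iff_not_hasGoodReductionAtPrime`). No input from Carayol's theorem.
[cite: DiamondShurman2005, Prop. 5.8.5 and (8.44)] -/
theorem not_dvd_level_of_good (hf : IsNewformOf W f) {p : ℕ} [Fact p.Prime] (hgood : Good W p) :
    ¬ p ∣ N := fun h ↦
  (W.dvd_conductorNorm_iff_not_hasGoodReductionAtPrime p).mp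
    ((hf.dvd_level_iff_dvd_conductorNorm Fact.out).mp h) hgood

/-- **The Heegner hypothesis for the level of the newform of `W` is the Heegner hypothesis for the
conductor of `W`** (any level `N`, `IsNewformOf W f`, any field `K`): `SatisfiesHeegnerHypothesis M K`
quantifies over the PRIME divisors of `M` only, and `N`, `N_W` have the same prime divisors
(`IsNewformOf.dvd_level_iff_dvd_conductorNorm`). No input from Carayol's theorem.
[cite: DiamondShurman2005, Prop. 5.8.5 and (8.44)] -/
theorem satisfiesHeegnerHypothesis_level_iff (hf : IsNewformOf W f) {K : Type} [Field K] :
    SatisfiesHeegnerHypothesis N K ↔ SatisfiesHeegnerHypothesis (W.conductorNorm ℤ) K :=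
  ⟨fun hH ℓ hℓ hℓN ↦ hH ℓ hℓ ((hf.dvd_level_iff_dvd_conductorNorm hℓ).mpr hℓN),
    fun hH ℓ hℓ hℓN ↦ hH ℓ hℓ ((hf.dvd_level_iff_dvd_conductorNorm hℓ).mp hℓN)⟩

end Level

/-! ## §1 The three leaves of `h308`, without Carayol -/

/-- **H1 from print, WITHOUT Carayol.** On the data of `h308` the BDP frame EXISTS: `p ∈ v`, an
embedding datum `ι'` inducing `v` exists (`X11b.exists_datum_forall_mem_iff`), `p ∤ N` and (Heeg) for
the level `N` of `Dt` (§0, from the prime support of `N` alone), `p` splits in `K`; then Castella–Hsieh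
2018 Def. 3.5 + Prop. 3.6 (`hCH`) gives the frame. = `KellerYinHalves.goodBDPExistsOnTree_of_castellaHsieh2018`
with the hypothesis `hC` deleted. CONDITIONAL on the one named PUBLISHED fact.
[cite: CastellaHsieh2018, Def. 3.5 and Prop. 3.6 (arXiv:1505.08165 pp. 10–11)]
[cite: DiamondShurman2005, Prop. 5.8.5 and (8.44)] -/
theorem goodBDPExistsOnTree_of_castellaHsieh2018' (hCH : castellaHsieh2018_exists_isBDPLFunction)
    (W : WeierstrassCurve ℚ) [W.IsElliptic] [W.IsGloballyMinimal] (p : ℕ) [Fact p.Prime] :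
    GoodBDPExistsOnTree W p := by
  intro hp hgood _hred _han _hGL K _ _ hK hHN hHp _hodd _h3 _hEK _hSel ι v vbar hv _hvbar _hne κ hκ γ _
    N _ Dt H ιC P _hP
  -- `p ∈ v`
  have hpv : ((p : ℕ) : 𝓞 K) ∈ v.asIdeal := by
    rw [hv]
    have h1 : ((((p : ℕ) : 𝓞 K) : K)) = (p : K) := by push_cast; rfl
    rw [h1, map_natCast, Padic.norm_p]
    exact inv_lt_one_of_one_lt₀ (by exact_mod_cast (Fact.out : p.Prime).one_lt)
  -- an embedding datum inducing `v`
  obtain ⟨ι₀⟩ := PadicAlgCl.nonempty_ringEquiv_complex p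
  obtain ⟨ι', -, hι'⟩ := X11b.exists_datum_forall_mem_iff p ι₀ hK hpv
  -- the level has the prime support of the conductor: `p ∤ N` and (Heeg) for `N`
  have hpN : ¬ p ∣ N := not_dvd_level_of_good Dt.isNewformOf hgood
  have hHeeg : SatisfiesHeegnerHypothesis N K :=
    (satisfiesHeegnerHypothesis_level_iff Dt.isNewformOf).mpr hHN
  have hsplit : ((Ideal.span {(p : ℤ)}).primesOver (𝓞 K)).ncard = 2 := hHp p Fact.out (dvd_refl p)
  obtain ⟨ΩK, Ωp, L, hΩK, hL⟩ := hCH ι' W K v κ γ Dt.isNewformOf (by omega) hpN hK hsplit hpv hι' hHeeg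
    hκ Fact.out
  exact ⟨ι', hι', ΩK, Ωp, L, hΩK, hL⟩

/-- **L-div from CGLS 2022 (proof of Thm. 4.2.2, first half), WITHOUT Carayol.** On the data of `h308`
and at EVERY frame `L`: `𝔛` is `Λ`-torsion and `p^k · L ∈ char_Λ(𝔛)·R₀⟦T⟧` for some `k`. Per datum:
`p ∤ N` and (Heeg) for `N` (§0); `p` splits; the fact (`hdiv`, Thm. 4.1.2 + Rem. 4.1.3 + Prop. 4.2.1
under (h1)) gives ONE frame `L₀` with the divisibility along `toUnr : ℤ_p → R₀`; IDEAL RIGIDITY ACROSS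
PERIODS (`X11b.R1.span_singleton_eq_of_isBDPLFunction`) gives `(L) = (L₀)`. =
`KellerYinHalves.goodLatticeDivOnTree_of_cgls` with the hypothesis `hC` deleted. CONDITIONAL on the one
named PUBLISHED fact.
[cite: CastellaGrossiLeeSkinner2022, proof of Thm. 4.2.2 (TeX L2343–L2352), Thm. 4.1.2, Rem. 4.1.3, Prop. 4.2.1]
[cite: DiamondShurman2005, Prop. 5.8.5 and (8.44)] -/
theorem goodLatticeDivOnTree_of_cgls'
    (hdiv : proofThm422_exists_isBDPLFunction_isTorsion_charIdeal_dvd)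
    (W : WeierstrassCurve ℚ) [W.IsElliptic] [W.IsGloballyMinimal] (p : ℕ) [Fact p.Prime] :
    GoodLatticeDivOnTree W p := by
  intro hp hgood hred _han _hGL K _ _ hK hHN hHp hodd h3 hEK hSel ι v vbar _hv hvbar hne κ hκ γ _ N _
    Dt H ιC P _hP ι' hι' ΩK Ωp L hΩK hL
  have hp2 : p ≠ 2 := by omega
  -- the level has the prime support of the conductor: `p ∤ N` and (Heeg) for `N`
  have hpN : ¬ p ∣ N := not_dvd_level_of_good Dt.isNewformOf hgood
  have hHeeg : SatisfiesHeegnerHypothesis N K :=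
    (satisfiesHeegnerHypothesis_level_iff Dt.isNewformOf).mpr hHN
  have hsplit : ((Ideal.span {(p : ℤ)}).primesOver (𝓞 K)).ncard = 2 := hHp p Fact.out (dvd_refl p)
  -- the published frame with torsion + divisibility
  obtain ⟨ΩK₀, Ωp₀, L₀, hΩK₀, hL₀, htors, hj⟩ := hdiv ι' W K v vbar κ γ Dt.isNewformOf hp2 hpN hred hK
    hHeeg hsplit hodd h3 hEK hSel hι' hvbar hne hκ
  obtain ⟨k, hk⟩ := hj (toUnr p) (coe_toUnr p)
  refine ⟨htors, k, ?_⟩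
  -- ideal rigidity: `(L) = (L₀)`
  have hΩp : ((Ωp : unrIntegers p) : ℂ_[p]) ≠ 0 := by
    rw [Ne, ZeroMemClass.coe_eq_zero]; exact Units.ne_zero Ωp
  have hΩp₀ : ((Ωp₀ : unrIntegers p) : ℂ_[p]) ≠ 0 := by
    rw [Ne, ZeroMemClass.coe_eq_zero]; exact Units.ne_zero Ωp₀
  have hspan : Ideal.span ({L} : Set (UnrSeries p)) = Ideal.span {L₀} :=
    X11b.R1.span_singleton_eq_of_isBDPLFunction hp2 hK hκ Fact.out hΩK₀ hΩK hΩp₀ hΩp hL₀ hL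
  have hmem : L ∈ Ideal.span ({L₀} : Set (UnrSeries p)) := hspan ▸ Ideal.mem_span_singleton_self L
  obtain ⟨a, ha⟩ := Ideal.mem_span_singleton'.mp hmem
  rw [← ha, mul_left_comm]
  exact Ideal.mul_mem_left _ a hk

/-- **L-val from CGLS 2022 Thm. 5.1.3 (Bertolini–Darmon–Prasanna), WITHOUT Carayol.** On the data of
`h308` and at EVERY frame `L`: `L(𝟙) = w · c_E⁻² (1 − a_p p⁻¹ + p⁻¹)² (log_{ω_E} P)²` with `w ∈ R₀ˣ`.
Per datum: `p ∤ N` and (Heeg) for `N` (§0); `ι_ℂ = w₀.embedding ∘ τ` for an involution `τ`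
(`exists_involution_map_eq`); the fact (`hval`) at `τ_* P` gives ONE frame `L₀` with its value; VALUE
RIGIDITY ACROSS PERIODS (`X11b.constantCoeff_eq_of_isBDPLFunction`) gives `[T⁰]L = [T⁰]L₀`; and
`(log_{ω_E} τ_* P)² = (log_{ω_E} P)²` (`sq_padicLogOmega_map_eq_of_selmerCorank_eq_one`). =
`KellerYinHalves.goodBDPValueOnTree_of_cgls` with the hypothesis `hC` deleted. CONDITIONAL on the one
named PUBLISHED fact.
[cite: CastellaGrossiLeeSkinner2022, Thm. 5.1.3 (TeX `thmpadicGZ`, L2463–L2471) with §5.1.2] [cite: BertoliniDarmonPrasanna2013, Thm. 5.13]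
[cite: DiamondShurman2005, Prop. 5.8.5 and (8.44)] -/
theorem goodBDPValueOnTree_of_cgls' (hval : thm513_exists_isBDPLFunction_valueAtOne)
    (W : WeierstrassCurve ℚ) [W.IsElliptic] [W.IsGloballyMinimal] (p : ℕ) [Fact p.Prime] :
    GoodBDPValueOnTree W p := by
  intro hp hgood _hred _han _hGL K _ _ hK hHN hHp _hodd _h3 _hEK hSel ι v vbar hv _hvbar _hne κ hκ γ _
    N _ Dt H ιC P hP ι' hι' ΩK Ωp L hΩK hL
  have hp2 : p ≠ 2 := by omega
  -- the level has the prime support of the conductor: `p ∤ N` and (Heeg) for `N`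
  have hpN : ¬ p ∣ N := not_dvd_level_of_good Dt.isNewformOf hgood
  have hHeeg : SatisfiesHeegnerHypothesis N K :=
    (satisfiesHeegnerHypothesis_level_iff Dt.isNewformOf).mpr hHN
  have hsplit : ((Ideal.span {(p : ℤ)}).primesOver (𝓞 K)).ncard = 2 := hHp p Fact.out (dvd_refl p)
  -- `p ∈ v`
  have hpv : ((p : ℕ) : 𝓞 K) ∈ v.asIdeal := by
    rw [hv]
    have h1 : ((((p : ℕ) : 𝓞 K) : K)) = (p : K) := by push_cast; rfl
    rw [h1, map_natCast, Padic.norm_p]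
    exact inv_lt_one_of_one_lt₀ (by exact_mod_cast (Fact.out : p.Prime).one_lt)
  -- the Galois re-reading of the datum through THE infinite place
  set w₀ : InfinitePlace K := Classical.arbitrary (InfinitePlace K)
  obtain ⟨τ, hτ, hP'⟩ := exists_involution_map_eq hK ιC w₀ Dt H hP
  -- the published frame at `τ_* P`, with its value at `𝟙`
  obtain ⟨ΩK₀, Ωp₀, L₀, hΩK₀, hL₀, u, hu⟩ := hval ι' W K v κ γ Dt H w₀ ι
    (WeierstrassCurve.Affine.Point.map τ.toRatAlgHom P) hp2 hpN hK hsplit hpv hι' hHeeg hκ Fact.out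
    hP' hv
  -- value rigidity across periods: equal constant terms
  have hΩp : ((Ωp : unrIntegers p) : ℂ_[p]) ≠ 0 := by
    rw [Ne, ZeroMemClass.coe_eq_zero]; exact Units.ne_zero Ωp
  have hΩp₀ : ((Ωp₀ : unrIntegers p) : ℂ_[p]) ≠ 0 := by
    rw [Ne, ZeroMemClass.coe_eq_zero]; exact Units.ne_zero Ωp₀
  have hcc : PowerSeries.constantCoeff L = PowerSeries.constantCoeff L₀ :=
    X11b.constantCoeff_eq_of_isBDPLFunction hp2 hK hκ Fact.out hΩK₀ hΩK hΩp₀ hΩp hL₀ hL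
  -- `(log τ_* P)² = (log P)²`
  have hlog := sq_padicLogOmega_map_eq_of_selmerCorank_eq_one W p ι hSel τ hτ P
  refine ⟨u, ?_⟩
  have hv0 := UnrSeries.eq_constantCoeff_of_hasValueAt_zero hu
  have h0 := UnrSeries.hasValueAt_zero L
  rw [hcc, ← hv0, hlog] at h0
  exact h0

/-! ## §2 `h308` from three published named facts and the one preprint statement -/

/-- **`h308` ⇐ {CH18 existence, CGLS proof of 4.2.2 (first half), CGLS Thm. 5.1.3} (PUBLISHED named
facts) + L-μλ — Carayol's theorem is NOT needed.** `KellerYinHalves.thm308_of_halves` on the three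
Carayol-free leaves of §1. = `KellerYinHalves.thm308_of_cgls_of_muLambda` with the hypothesis `hC`
deleted: on line `halves` the preprint content is the ONE statement `GoodLatticeMuLambdaOnTree`, and the
published content of the BDP side is THREE named facts, not four. CONDITIONAL on the named inputs; nothing
booked, no label moves. [cite: KellerYin2024, Thm. 3.0.8 (IMC2), Thm. 1.5.1, Thms. 2.2.1–2.2.3]
[cite: CastellaGrossiLeeSkinner2022, Thm. 4.1.2, Rem. 4.1.3, Prop. 4.2.1, Thm. 5.1.3]
[cite: CastellaHsieh2018, Def. 3.7 and Prop. 3.8] [cite: DiamondShurman2005, Prop. 5.8.5 and (8.44)] -/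
theorem thm308_of_cgls_of_muLambda' (hCH : castellaHsieh2018_exists_isBDPLFunction)
    (hdiv : proofThm422_exists_isBDPLFunction_isTorsion_charIdeal_dvd)
    (hval : thm513_exists_isBDPLFunction_valueAtOne)
    (hml : ∀ (W : WeierstrassCurve ℚ) [W.IsElliptic] [W.IsGloballyMinimal] (p : ℕ) [Fact p.Prime],
      GoodLatticeMuLambdaOnTree W p) :
    thm308_imc2_bdpValue_goodLattice_OPEN :=
  thm308_of_halves (fun W _ _ p _ ↦ goodBDPExistsOnTree_of_castellaHsieh2018' hCH W p)
    (fun W _ _ p _ ↦ goodLatticeDivOnTree_of_cgls' hdiv W p) hml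
    (fun W _ _ p _ ↦ goodBDPValueOnTree_of_cgls' hval W p)

end Summit.BirchSwinnertonDyer.BirchSwinnertonDyer.Theorems.GoodLatticeBDPValueHalvesNoCarayol

end
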